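import Mathlib
import Literature.AlgebraicGeometry.Resolution.CobordantGame
import Literature.AlgebraicGeometry.Resolution.CobordantChartCoefficients
import Literature.AlgebraicGeometry.Resolution.CobordantChartPlaneSlice
import Literature.AlgebraicGeometry.Resolution.CobordantTupleGame
import Literature.AlgebraicGeometry.Resolution.FormalCoordinateChange
import Summits.ResolutionOfSingularities.ResolutionOfSingularities.Theorems.WeightedInvariantLocalWeightedDropMonicLift
import Summits.ResolutionOfSingularities.ResolutionOfSingularities.Theorems.WeightedInvariantLocalWeightedDropWildUnaryConeMonic
import Summits.ResolutionOfSingularities.ResolutionOfSingularities.Theorems.WeightedInvariantLocalWeightedDropApexFreeOrderDrop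

/-!
# `WeightedInvariant.LocalWeightedDrop`, line `hasse-ridge-face-selection`: coefficient calculus for the TERMINAL purely
# inseparable surface forms `y^d + A₀(x₁,x₂)` (charts, slices, orders, the apex of a binomial cone)

Crux item stmt-ResolutionOfSingularities-8899 `LocalWeightedDrop` (route `ResolutionOfSingularities/WeightedInvariant`),
serving the door `WeightedConstruction` stmt-ResolutionOfSingularities-0571.  [OURS · L1 W4.3, chain w43, stub worker 1
(gen 2): helpers for the candidate piece S3πT `stub_wildPurelyInseparableTerminalWon` of the S3 cut (terminal cases of
Hauser–Perlega, PRIMS 60 (2024) §3, in the local weighted resolution game).  Not a statement of any manuscript.]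

Contents (all elementary), part 1 of 2 (part 2: `…WildTerminalApex`):
* orders: `order_X_pow_mul`, `order_monomialUnit` (`ord (x₁^r x₂^s U) = r + s`), `order_X_pow_add_rename_le` /
  `order_X_pow_add_rename_eq` (`ord (y^d + A₀(x'))` vs `ord A₀`), the collapsed monic form `monicForm_eq_of_vanish`;
* the plane slices `TupleGame.slice 0 / 1 : k[[s,y₁,y₂]] → k[[·,·]]` on variables and constants, and the constant
  coefficient under a substitution without constant terms (`constantCoeff_subst_of_constantCoeff_zero`);
* the point chart and the axis charts of the curve blow-ups `V(x_i, y)` on monomials (`subst_pointChart_monomialUnit`,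
  `slice_subst_axisChart_X_pow_mul`), the slices of the point-chart factor (`slice_zero_pointFactor`,
  `slice_one_pointFactor`), cancelling powers of the exceptional variable.
-/

set_option linter.dupNamespace false -- mandated namespace of this single-conjunct summit

namespace Summit.ResolutionOfSingularities.ResolutionOfSingularities.Theorems

open Literature.AlgebraicGeometry.Resolution

namespace WildTerminal

open MvPowerSeries Literature.AlgebraicGeometry.Resolution.CobordantGame

variable {k : Type} [Field k]

/-! ### Orders -/

/-- `ord (x_i^n · g) = n + ord g`. -/
theorem order_X_pow_mul {σ : Type} (i : σ) (n : ℕ) (g : MvPowerSeries σ k) :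
    ((X i : MvPowerSeries σ k) ^ n * g).order = n + g.order := by
  rw [MvPowerSeries.order_mul, X_pow_eq, order_monomial_of_ne_zero one_ne_zero, Finsupp.degree_single]

/-- A series with non-zero constant coefficient has order `0`. -/
theorem order_eq_zero_of_constantCoeff_ne_zero {σ : Type} {U : MvPowerSeries σ k} (hU : constantCoeff U ≠ 0) :
    U.order = 0 := by
  have h := order_le (f := U) (d := 0) (by rwa [coeff_zero_eq_constantCoeff_apply])
  rw [map_zero, Nat.cast_zero] at h
  exact le_antisymm h bot_le

/-- `ord (x₁^r · x₂^s · U) = r + s` for a unit `U`. -/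
theorem order_monomialUnit (r s : ℕ) {U : MvPowerSeries (Fin 2) k} (hU : constantCoeff U ≠ 0) :
    ((X 0 : MvPowerSeries (Fin 2) k) ^ r * X 1 ^ s * U).order = ((r + s : ℕ) : ℕ∞) := by
  rw [mul_assoc, order_X_pow_mul, order_X_pow_mul, order_eq_zero_of_constantCoeff_ne_zero hU, add_zero, Nat.cast_add]

/-- A monomial times a unit is non-zero. -/
theorem monomialUnit_ne_zero (r s : ℕ) {U : MvPowerSeries (Fin 2) k} (hU : constantCoeff U ≠ 0) :
    (X 0 : MvPowerSeries (Fin 2) k) ^ r * X 1 ^ s * U ≠ 0 := by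
  intro h
  have h2 := order_monomialUnit r s hU
  rw [h, order_zero] at h2
  exact ENat.top_ne_coe _ h2

/-- `ord (x_i^n · g) < ⊤` forces `g ≠ 0`; in particular a small residual form is non-zero. -/
theorem ne_zero_of_order_lt {σ : Type} {g : MvPowerSeries σ k} {n : ℕ} (h : g.order < n) : g ≠ 0 := by
  rintro rfl
  rw [order_zero] at h
  exact absurd h (not_lt.mpr le_top)

/-- Coefficients of `y^d + A₀(x')` at `x'^β y^n`. -/
theorem coeff_X_pow_add_rename {m : ℕ} (d : ℕ) (G : MvPowerSeries (Fin m) k) (β : Fin m →₀ ℕ) (n : ℕ) :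
    coeff (Finsupp.embDomain (Fin.succAboveEmb (Fin.last m)) β + Finsupp.single (Fin.last m) n)
        ((X (Fin.last m) : MvPowerSeries (Fin (m + 1)) k) ^ d + rename (Fin.succAboveEmb (Fin.last m)) G) =
      (if d = n ∧ β = 0 then 1 else 0) + (if n = 0 then coeff β G else 0) := by
  classical
  rw [map_add, TschirnhausForm.coeff_emb_add_single_rename, coeff_X_pow]
  congr 1
  by_cases h : d = n ∧ β = 0
  · rw [if_pos h, if_pos]
    rw [h.2, Finsupp.embDomain_zero, zero_add, h.1]
  · rw [if_neg h, if_neg]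
    intro hE
    apply h
    have hl := DFunLike.congr_fun hE (Fin.last m)
    rw [TschirnhausForm.emb_add_single_last, Finsupp.single_eq_same] at hl
    refine ⟨hl.symm, ?_⟩
    ext j
    have hj := DFunLike.congr_fun hE (Fin.castSucc j)
    rw [TschirnhausForm.emb_add_single_castSucc, Finsupp.single_eq_of_ne (Fin.castSucc_lt_last j).ne] at hj
    exact hj

/-- `ord (y^d + A₀(x')) ≤ ord A₀` for `d ≥ 1`. -/
theorem order_X_pow_add_rename_le {m : ℕ} {d : ℕ} (hd : 0 < d) (G : MvPowerSeries (Fin m) k) :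
    ((X (Fin.last m) : MvPowerSeries (Fin (m + 1)) k) ^ d + rename (Fin.succAboveEmb (Fin.last m)) G).order ≤
      G.order := by
  classical
  by_cases hG : G = 0
  · rw [hG, order_zero]
    exact le_top
  · have hfin : G.order ≠ ⊤ := by rwa [Ne, order_eq_top_iff]
    obtain ⟨n, hn⟩ := ENat.ne_top_iff_exists.mp hfin
    obtain ⟨⟨β, hβ, hβd⟩, -⟩ := order_eq_nat.mp hn.symm
    have h := order_le (f := (X (Fin.last m) : MvPowerSeries (Fin (m + 1)) k) ^ d +
        rename (Fin.succAboveEmb (Fin.last m)) G)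
      (d := Finsupp.embDomain (Fin.succAboveEmb (Fin.last m)) β + Finsupp.single (Fin.last m) 0) (by
        rw [coeff_X_pow_add_rename, if_pos rfl, if_neg (fun h => by omega), zero_add]
        exact hβ)
    rw [TschirnhausForm.degree_emb_add_single, add_zero, hβd] at h
    rwa [← hn]

/-- `ord (y^d + A₀(x')) = d` as soon as `ord A₀ ≥ d` (`d ≥ 1`). -/
theorem order_X_pow_add_rename_eq {m : ℕ} {d : ℕ} (hd : 0 < d) (G : MvPowerSeries (Fin m) k)
    (hG : (d : ℕ∞) ≤ G.order) :
    ((X (Fin.last m) : MvPowerSeries (Fin (m + 1)) k) ^ d + rename (Fin.succAboveEmb (Fin.last m)) G).order = d := by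
  classical
  refine le_antisymm ?_ (nat_le_order fun E hE => ?_)
  · have h := order_le (f := (X (Fin.last m) : MvPowerSeries (Fin (m + 1)) k) ^ d +
        rename (Fin.succAboveEmb (Fin.last m)) G) (d := Finsupp.single (Fin.last m) d) (by
      have h1 := coeff_X_pow_add_rename d G 0 d
      rw [Finsupp.embDomain_zero, zero_add] at h1
      rw [h1, if_pos ⟨rfl, rfl⟩, if_neg (by omega), add_zero]
      exact one_ne_zero)
    rwa [Finsupp.degree_single] at h
  · obtain ⟨β, hEeq⟩ := TschirnhausForm.exists_eq_emb_add_single E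
    have hdeg := TschirnhausForm.degree_emb_add_single β (E (Fin.last m))
    rw [← hEeq] at hdeg
    rw [hEeq, coeff_X_pow_add_rename, if_neg, zero_add]
    · split_ifs with h0
      · apply coeff_of_lt_order
        refine lt_of_lt_of_le ?_ hG
        exact_mod_cast (by omega : β.degree < d)
      · rfl
    · rintro ⟨hdn, -⟩
      omega

/-- A monic form whose coefficients `A_j`, `j ≠ 0`, vanish is `y^d + A₀(x')`. -/
theorem monicForm_eq_of_vanish {m d : ℕ} (hd : 0 < d) (T : Fin d → MvPowerSeries (Fin m) k)
    (hT : ∀ j : Fin d, (j : ℕ) ≠ 0 → T j = 0) :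
    (X (Fin.last m) : MvPowerSeries (Fin (m + 1)) k) ^ d +
        ∑ j : Fin d, rename (Fin.succAboveEmb (Fin.last m)) (T j) * X (Fin.last m) ^ (j : ℕ) =
      X (Fin.last m) ^ d + rename (Fin.succAboveEmb (Fin.last m)) (T ⟨0, hd⟩) := by
  congr 1
  rw [Finset.sum_eq_single ⟨0, hd⟩]
  · simp
  · intro j _ hj
    rw [hT j (fun h => hj (Fin.ext h)), map_zero, zero_mul]
  · intro h
    exact absurd (Finset.mem_univ _) h

/-- The polyhedron condition for the collapsed tuple `(A₀, 0, …, 0)` is `ord A₀ > d`. -/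
theorem polyhedron_of_vanish {m d : ℕ} (hd : 0 < d) (T : Fin d → MvPowerSeries (Fin m) k)
    (hT : ∀ j : Fin d, (j : ℕ) ≠ 0 → T j = 0) (h0 : (d : ℕ∞) < (T ⟨0, hd⟩).order) :
    ∀ j : Fin d, ((d - (j : ℕ) : ℕ) : ℕ∞) < (T j).order := by
  intro j
  by_cases hj : (j : ℕ) = 0
  · have : j = ⟨0, hd⟩ := Fin.ext hj
    subst this
    simpa using h0
  · rw [hT j hj, order_zero]
    exact ENat.coe_lt_top _

/-! ### The plane slices `TupleGame.slice i : k[[s, y₁, y₂]] → k[[·, ·]]` (`i : Fin 2`) -/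

/-- The slice is multiplicative. -/
theorem slice_mul {m : ℕ} (i : Fin m) (G H : MvPowerSeries (Fin (m + 1)) k) :
    TupleGame.slice i (G * H) = TupleGame.slice i G * TupleGame.slice i H := by
  unfold TupleGame.slice
  rw [subst_mul (CobordantChartPlaneSlice.hasSubst_slice i)]

/-- The slice commutes with powers. -/
theorem slice_pow {m : ℕ} (i : Fin m) (G : MvPowerSeries (Fin (m + 1)) k) (n : ℕ) :
    TupleGame.slice i (G ^ n) = TupleGame.slice i G ^ n := by
  unfold TupleGame.slice
  rw [subst_pow (CobordantChartPlaneSlice.hasSubst_slice i)]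

/-- The slice fixes constants. -/
theorem slice_C {m : ℕ} (i : Fin m) (a : k) :
    TupleGame.slice i (C a : MvPowerSeries (Fin (m + 1)) k) = C a := by
  unfold TupleGame.slice
  rw [subst_C]

/-- The slice of `0` is `0`. -/
theorem slice_zero {m : ℕ} (i : Fin m) : TupleGame.slice i (0 : MvPowerSeries (Fin (m + 1)) k) = 0 := by
  unfold TupleGame.slice
  rw [← coe_substAlgHom (CobordantChartPlaneSlice.hasSubst_slice i), map_zero]

/-- The slice fixes the exceptional variable `s = X 0`. -/
theorem slice_X_zero {m : ℕ} (i : Fin (m + 1)) :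
    TupleGame.slice i (X 0 : MvPowerSeries (Fin (m + 1 + 1)) k) = X 0 := by
  unfold TupleGame.slice
  rw [subst_X (CobordantChartPlaneSlice.hasSubst_slice i), if_neg (Fin.succ_ne_zero _).symm, Fin.predAbove_right_zero]

/-- The slice kills its own variable `y_i = X i.succ`. -/
theorem slice_X_succ_self {m : ℕ} (i : Fin m) :
    TupleGame.slice i (X i.succ : MvPowerSeries (Fin (m + 1)) k) = 0 := by
  unfold TupleGame.slice
  rw [subst_X (CobordantChartPlaneSlice.hasSubst_slice i), if_pos rfl]

/-- `slice 0 (y₂) = x₂'` in `k[[s, y₁, y₂]] → k[[x₁', x₂']]`. -/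
theorem slice_zero_X_two : TupleGame.slice (0 : Fin 2) (X 2 : MvPowerSeries (Fin (2 + 1)) k) = X 1 := by
  unfold TupleGame.slice
  rw [subst_X (CobordantChartPlaneSlice.hasSubst_slice _), if_neg (by decide)]
  rfl

/-- `slice 1 (y₁) = x₂'` in `k[[s, y₁, y₂]] → k[[x₁', x₂']]`. -/
theorem slice_one_X_one : TupleGame.slice (1 : Fin 2) (X 1 : MvPowerSeries (Fin (2 + 1)) k) = X 1 := by
  unfold TupleGame.slice
  rw [subst_X (CobordantChartPlaneSlice.hasSubst_slice _), if_neg (by decide)]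
  rfl

/-- The constant coefficient survives the slice. -/
theorem constantCoeff_slice {m : ℕ} (i : Fin m) (G : MvPowerSeries (Fin (m + 1)) k) :
    constantCoeff (TupleGame.slice i G) = constantCoeff G := by
  unfold TupleGame.slice
  rw [← coeff_zero_eq_constantCoeff_apply, CobordantChartPlaneSlice.coeff_subst_slice, Finsupp.mapDomain_zero,
    coeff_zero_eq_constantCoeff_apply]

/-- A substitution WITHOUT CONSTANT TERMS preserves the constant coefficient. -/
theorem constantCoeff_subst_of_constantCoeff_zero {σ τ : Type} [Finite σ] {a : σ → MvPowerSeries τ k}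
    (ha : ∀ i, constantCoeff (a i) = 0) (f : MvPowerSeries σ k) :
    constantCoeff (subst a f) = constantCoeff f := by
  classical
  have hs : HasSubst a := hasSubst_of_constantCoeff_zero ha
  rw [constantCoeff_subst hs, finsum_eq_single _ 0]
  · simp
  · intro d hd
    obtain ⟨i, hi⟩ : ∃ i, d i ≠ 0 := Finsupp.ne_iff.mp hd
    have hzero : constantCoeff (d.prod fun s e => a s ^ e) = 0 := by
      rw [Finsupp.prod, map_prod]
      exact Finset.prod_eq_zero (Finsupp.mem_support_iff.mpr hi) (by rw [map_pow, ha i, zero_pow hi])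
    rw [hzero, smul_zero]

/-! ### The point chart and the axis charts on monomials -/

/-- The point chart (all weights `1`) is substitutable. -/
theorem hasSubst_pointChart {m : ℕ} (c : Fin m → k) :
    HasSubst (CobordantChart.chart (fun _ : Fin m => 1) c) :=
  CobordantChart.hasSubst_chart _ c (fun _ hi => absurd hi one_ne_zero)

/-- The components of the point chart of the plane: `x₁ ↦ s · (c₁ + y₁)`. -/
theorem pointChart_zero (c : Fin 2 → k) :
    CobordantChart.chart (fun _ : Fin 2 => 1) c 0 = (X 0 : MvPowerSeries (Fin (2 + 1)) k) * (C (c 0) + X 1) := by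
  rw [CobordantChart.chart_apply, pow_one]
  rfl

/-- The components of the point chart of the plane: `x₂ ↦ s · (c₂ + y₂)`. -/
theorem pointChart_one (c : Fin 2 → k) :
    CobordantChart.chart (fun _ : Fin 2 => 1) c 1 = (X 0 : MvPowerSeries (Fin (2 + 1)) k) * (C (c 1) + X 2) := by
  rw [CobordantChart.chart_apply, pow_one]
  rfl

/-- The components of a chart have zero constant term. -/
theorem constantCoeff_chart {m : ℕ} (w : Fin m → ℕ) (c : Fin m → k) (hc : ∀ i, w i = 0 → c i = 0) (l : Fin m) :
    constantCoeff (CobordantChart.chart w c l) = 0 := by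
  rw [CobordantChart.chart_apply, map_mul, map_add, constantCoeff_C, constantCoeff_X, add_zero, map_pow, constantCoeff_X]
  by_cases h : w l = 0
  · rw [hc l h, mul_zero]
  · rw [zero_pow h, zero_mul]

/-- THE POINT CHART ON A MONOMIAL TIMES A UNIT: `(x₁^r x₂^s U) ∘ chart(c) = s^{r+s} · ((c₁+y₁)^r (c₂+y₂)^s · U ∘ chart(c))`. -/
theorem subst_pointChart_monomialUnit (c : Fin 2 → k) (r s : ℕ) (U : MvPowerSeries (Fin 2) k) :
    subst (CobordantChart.chart (fun _ : Fin 2 => 1) c) ((X 0 : MvPowerSeries (Fin 2) k) ^ r * X 1 ^ s * U) =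
      (X 0 : MvPowerSeries (Fin (2 + 1)) k) ^ (r + s) * ((C (c 0) + X 1) ^ r * (C (c 1) + X 2) ^ s *
        subst (CobordantChart.chart (fun _ : Fin 2 => 1) c) U) := by
  have hs := hasSubst_pointChart c
  rw [← coe_substAlgHom hs]
  simp only [map_mul, map_pow]
  rw [coe_substAlgHom, subst_X hs, subst_X hs, pointChart_zero, pointChart_one, mul_pow, mul_pow, pow_add]
  ring

/-- The axis chart of the curve blow-up `V(x_i, y)` (weight `e_i`, exceptional point `c_i e_i`) is substitutable. -/
theorem hasSubst_axisChart (i : Fin 2) (ci : k) :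
    HasSubst (CobordantChart.chart (fun l : Fin 2 => if l = i then 1 else 0) (fun l : Fin 2 => if l = i then ci else 0)) :=
  CobordantChart.hasSubst_chart _ _ (fun l hl => by
    by_cases h : l = i
    · simp [h] at hl
    · simp [h])

/-- The axis chart on its own variable: `x_i ↦ s · (c_i + y_i)`. -/
theorem axisChart_self (i : Fin 2) (ci : k) :
    CobordantChart.chart (fun l : Fin 2 => if l = i then 1 else 0) (fun l : Fin 2 => if l = i then ci else 0) i =
      (X 0 : MvPowerSeries (Fin (2 + 1)) k) * (C ci + X i.succ) := by
  rw [CobordantChart.chart_apply, if_pos rfl, if_pos rfl, pow_one]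

/-- The axis chart on the other variable: `x_l ↦ y_l`. -/
theorem axisChart_other (i l : Fin 2) (hl : l ≠ i) (ci : k) :
    CobordantChart.chart (fun l : Fin 2 => if l = i then 1 else 0) (fun l : Fin 2 => if l = i then ci else 0) l =
      (X l.succ : MvPowerSeries (Fin (2 + 1)) k) := by
  rw [CobordantChart.chart_apply, if_neg hl, if_neg hl, pow_zero, one_mul, map_zero, zero_add]

/-- THE AXIS CHART ON `x_i^n · g`: `(x_i^n g) ∘ chart_i = (s (c_i + y_i))^n · (g ∘ chart_i)`. -/
theorem subst_axisChart_X_pow_mul (i : Fin 2) (ci : k) (n : ℕ) (g : MvPowerSeries (Fin 2) k) :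
    subst (CobordantChart.chart (fun l : Fin 2 => if l = i then 1 else 0) (fun l : Fin 2 => if l = i then ci else 0))
        ((X i : MvPowerSeries (Fin 2) k) ^ n * g) =
      ((X 0 : MvPowerSeries (Fin (2 + 1)) k) * (C ci + X i.succ)) ^ n *
        subst (CobordantChart.chart (fun l : Fin 2 => if l = i then 1 else 0) (fun l : Fin 2 => if l = i then ci else 0)) g := by
  have hs := hasSubst_axisChart i ci
  rw [← coe_substAlgHom hs, map_mul, map_pow, coe_substAlgHom, subst_X hs, axisChart_self]

/-- THE SLICE OF THE AXIS-CHART TRANSFORM of `x_i^n · g` at `y_i = 0`: `(c_i s)^n · (g ∘ chart_i)|`. -/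
theorem slice_subst_axisChart_X_pow_mul (i : Fin 2) (ci : k) (n : ℕ) (g : MvPowerSeries (Fin 2) k) :
    TupleGame.slice i (subst (CobordantChart.chart (fun l : Fin 2 => if l = i then 1 else 0)
        (fun l : Fin 2 => if l = i then ci else 0)) ((X i : MvPowerSeries (Fin 2) k) ^ n * g)) =
      (C ci * X 0 : MvPowerSeries (Fin 2) k) ^ n * TupleGame.slice i (subst (CobordantChart.chart
        (fun l : Fin 2 => if l = i then 1 else 0) (fun l : Fin 2 => if l = i then ci else 0)) g) := by
  rw [subst_axisChart_X_pow_mul, slice_mul, slice_pow, slice_mul, slice_X_zero]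
  congr 2
  unfold TupleGame.slice
  rw [subst_add (CobordantChartPlaneSlice.hasSubst_slice i), subst_C, subst_X (CobordantChartPlaneSlice.hasSubst_slice i),
    if_pos rfl, add_zero, mul_comm]

/-! ### The slice of the point-chart factor `(c₁ + y₁)^r (c₂ + y₂)^s · U∘chart` -/

/-- The slice is additive. -/
theorem slice_add {m : ℕ} (i : Fin m) (G H : MvPowerSeries (Fin (m + 1)) k) :
    TupleGame.slice i (G + H) = TupleGame.slice i G + TupleGame.slice i H := by
  unfold TupleGame.slice
  rw [subst_add (CobordantChartPlaneSlice.hasSubst_slice i)]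

/-- `slice 0 (y₁) = 0`. -/
theorem slice_zero_X_one : TupleGame.slice (0 : Fin 2) (X 1 : MvPowerSeries (Fin (2 + 1)) k) = 0 := by
  unfold TupleGame.slice
  rw [subst_X (CobordantChartPlaneSlice.hasSubst_slice _), if_pos (by decide)]

/-- `slice 1 (y₂) = 0`. -/
theorem slice_one_X_two : TupleGame.slice (1 : Fin 2) (X 2 : MvPowerSeries (Fin (2 + 1)) k) = 0 := by
  unfold TupleGame.slice
  rw [subst_X (CobordantChartPlaneSlice.hasSubst_slice _), if_pos (by decide)]

/-- THE SLICE `y₁ = 0` OF THE POINT-CHART FACTOR: `c₁^r · (c₂ + x₂')^s · U'`. -/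
theorem slice_zero_pointFactor (c : Fin 2 → k) (r s : ℕ) (Uc : MvPowerSeries (Fin (2 + 1)) k) :
    TupleGame.slice (0 : Fin 2) ((C (c 0) + X 1) ^ r * (C (c 1) + X 2) ^ s * Uc) =
      C (c 0) ^ r * (C (c 1) + X 1) ^ s * TupleGame.slice (0 : Fin 2) Uc := by
  rw [slice_mul, slice_mul, slice_pow, slice_pow, slice_add, slice_add, slice_C, slice_C, slice_zero_X_one, slice_zero_X_two,
    add_zero]

/-- THE SLICE `y₂ = 0` OF THE POINT-CHART FACTOR: `(c₁ + x₂')^r · c₂^s · U'`. -/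
theorem slice_one_pointFactor (c : Fin 2 → k) (r s : ℕ) (Uc : MvPowerSeries (Fin (2 + 1)) k) :
    TupleGame.slice (1 : Fin 2) ((C (c 0) + X 1) ^ r * (C (c 1) + X 2) ^ s * Uc) =
      (C (c 0) + X 1) ^ r * C (c 1) ^ s * TupleGame.slice (1 : Fin 2) Uc := by
  rw [slice_mul, slice_mul, slice_pow, slice_pow, slice_add, slice_add, slice_C, slice_C, slice_one_X_one, slice_one_X_two,
    add_zero]

/-- A variable is a non-zero series. -/
theorem X_ne_zero' {σ : Type} (i : σ) : (X i : MvPowerSeries σ k) ≠ 0 := by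
  classical
  intro h
  have h1 := congrArg (coeff (Finsupp.single i 1)) h
  rw [coeff_X, if_pos rfl, map_zero] at h1
  exact one_ne_zero h1

/-- Cancelling a power of the exceptional variable. -/
theorem eq_of_X_pow_mul_eq {σ : Type} (i : σ) (n : ℕ) {G H : MvPowerSeries σ k}
    (h : (X i : MvPowerSeries σ k) ^ n * G = X i ^ n * H) : G = H :=
  mul_left_cancel₀ (pow_ne_zero n (X_ne_zero' i)) h

/-- A product `s^n · B` vanishes only if `B` does. -/
theorem eq_zero_of_X_pow_mul_eq_zero {σ : Type} (i : σ) (n : ℕ) {G : MvPowerSeries σ k}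
    (h : (X i : MvPowerSeries σ k) ^ n * G = 0) : G = 0 :=
  (mul_eq_zero.mp h).resolve_left (pow_ne_zero n (X_ne_zero' i))

end WildTerminal

end Summit.ResolutionOfSingularities.ResolutionOfSingularities.Theorems
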